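import Mathlib
import HarnessLib

/-!
# Quenouille's example, exactly: the jackknife of the plug-in variance IS the unbiased variance

HONEST FRAMING: exact (Metropolis-corrected) sampling algorithms for lattice gauge theory;
figures of merit are autocorrelation/cost numbers at stated couplings and volumes; no
continuum-physics claim.

Venture `LatticeQCDFlow` (cell pub-lqcd), topic `Exactness`; FANOUT row 13 (`eng-snf`, GEN-25).
NEW WORK of the cell (elementary algebra), Mathlib only; not a published result; no definition;
nothing cited as a fact (Quenouille 1956 / Tukey 1958 NAMED ONLY).  Companion of GEN-25
`NCMCGeneralSpaceReplicaJackknifePseudoValues` (for ANY statistic `(bias_corr, err)` = replica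
mean / replica-`t` s.e. of the pseudo-values), `…PseudoValuesMean` (LINEAR statistics:
pseudo-values = block values, `bias_corr = full`) and `…BiasSize` / `…RatioBias` (smooth
NONLINEAR statistics: the correction is second order).  This file is the QUADRATIC case, where
the correction is neither zero nor small but EXACTLY RIGHT.

WHY (row 13).  For `n ≥ 2` block values `x_i` with mean `x̄` the plug-in variance
`V = (1/n)Σ_i (x_i − x̄)²` has expectation `((n−1)/n)σ²` under i.i.d. sampling; its
delete-one replicates are `V_{(−i)} = (1/(n−1))Σ_{j≠i}(x_j − x̄_{(−i)})²`.  The DOWNDATING identity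

  `Σ_{j≠i}(x_j − x̄_{(−i)})² = Σ_j (x_j − x̄)² − (n/(n−1))·(x_i − x̄)²` (`sum_erase_sq_sub_looMean`)

makes Tukey's pseudo-values explicit, `n·V − (n−1)·V_{(−i)} = (n/(n−1))·(x_i − x̄)²`
(`pseudoValue_plugInVariance_eq`), so the Quenouille–Tukey corrected value is

  **`n·V − (n−1)·(1/n)Σ_i V_{(−i)} = (1/(n−1)) Σ_i (x_i − x̄)² = s²`**
  (`jackknife_biasCorrected_plugInVariance_eq_sampleVariance`):

the delete-one jackknife removes the `O(1/n)` bias of a quadratic statistic EXACTLY — run with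
singleton blocks (`n_blocks = n`, which `estimators._blocks` permits) on the plug-in variance of
the works, the engine's generic `jackknife(...)[1]` (`bias_corr`) returns exactly
`W.var(ddof=1)`, the number `free_energy` prints as `var_W`; with `R` equal blocks of block
values `x_r` it returns the unbiased between-block variance.  A unit identity, no tuning.

* `sum_sq_sub_mean_eq` — `Σ_{j∈s}(x_j − x̄_s)² = Σ_s x² − (Σ_s x)²/|s|`;
* **`sum_erase_sq_sub_looMean`**, **`pseudoValue_plugInVariance_eq`**,
  **`jackknife_biasCorrected_plugInVariance_eq_sampleVariance`**.

NOT CLAIMED: anything stochastic (unbiasedness itself is a statement about a law and is not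
restated here); anything numerical.
-/

namespace Summit.Ventures.LatticeQCDFlow.Exactness.GeneralNCMC

open Finset

section PlugInVariance

variable {ι : Type*}

/-- `Σ_{j∈s}(x_j − c)² = Σ_s x² − 2c·Σ_s x + |s|·c²` (private: the same three-line identity
exists under `Literature.…BlockPoincare`, not worth an import here). -/
private theorem sum_sq_sub_eq (s : Finset ι) (x : ι → ℝ) (c : ℝ) :
    ∑ j ∈ s, (x j - c) ^ 2 = ∑ j ∈ s, x j ^ 2 - 2 * c * ∑ j ∈ s, x j + s.card * c ^ 2 := by
  have h : ∀ j, (x j - c) ^ 2 = x j ^ 2 - 2 * c * x j + c ^ 2 := fun j => by ring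
  simp_rw [h, sum_add_distrib, sum_sub_distrib, ← mul_sum, sum_const, nsmul_eq_mul]

/-- `Σ_{j∈s}(x_j − x̄_s)² = Σ_s x² − (Σ_s x)²/|s|` for a nonempty `s` (`x̄_s = (Σ_s x)/|s|`). -/
theorem sum_sq_sub_mean_eq (s : Finset ι) (hs : s.Nonempty) (x : ι → ℝ) :
    ∑ j ∈ s, (x j - (∑ k ∈ s, x k) / s.card) ^ 2
      = ∑ j ∈ s, x j ^ 2 - (∑ j ∈ s, x j) ^ 2 / s.card := by
  have hc : (s.card : ℝ) ≠ 0 := by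
    have := hs.card_pos
    positivity
  rw [sum_sq_sub_eq]
  field_simp
  ring

variable [Fintype ι] [DecidableEq ι]

/-- **Downdating**: `Σ_{j≠i}(x_j − x̄_{(−i)})² = Σ_j (x_j − x̄)² − (n/(n−1))·(x_i − x̄)²`
(`n ≥ 2`, `x̄ = (Σx)/n`, `x̄_{(−i)} = (Σ_{j≠i} x_j)/(n−1)`). -/
theorem sum_erase_sq_sub_looMean (hn : 2 ≤ Fintype.card ι) (x : ι → ℝ) (i : ι) :
    ∑ j ∈ univ.erase i, (x j - (∑ k ∈ univ.erase i, x k) / ((Fintype.card ι : ℝ) - 1)) ^ 2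
      = ∑ j, (x j - (∑ k, x k) / Fintype.card ι) ^ 2
          - Fintype.card ι / ((Fintype.card ι : ℝ) - 1)
              * (x i - (∑ k, x k) / Fintype.card ι) ^ 2 := by
  have hnpos : 0 < Fintype.card ι := by omega
  haveI : Nonempty ι := Fintype.card_pos_iff.mp hnpos
  have hn0 : (Fintype.card ι : ℝ) ≠ 0 := by positivity
  have hn1 : (Fintype.card ι : ℝ) - 1 ≠ 0 := by
    have : (2 : ℝ) ≤ Fintype.card ι := by exact_mod_cast hn
    linarith
  have hcard : ((univ.erase i).card : ℝ) = (Fintype.card ι : ℝ) - 1 := by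
    rw [card_erase_of_mem (mem_univ i), card_univ, Nat.cast_sub (by omega), Nat.cast_one]
  have hne : (univ.erase i).Nonempty := by
    rw [← Finset.card_pos, card_erase_of_mem (mem_univ i), card_univ]; omega
  have hL := sum_sq_sub_mean_eq (univ.erase i) hne x
  rw [hcard] at hL
  have hU := sum_sq_sub_mean_eq (univ : Finset ι) univ_nonempty x
  rw [card_univ] at hU
  rw [hL, hU, sum_erase_eq_sub (mem_univ i), sum_erase_eq_sub (mem_univ i)]
  field_simp
  ring

/-- **The pseudo-values of the plug-in variance**:
`n·V − (n−1)·V_{(−i)} = (n/(n−1))·(x_i − x̄)²` with `V = (1/n)Σ_j (x_j − x̄)²`,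
`V_{(−i)} = (1/(n−1))Σ_{j≠i}(x_j − x̄_{(−i)})²`. -/
theorem pseudoValue_plugInVariance_eq (hn : 2 ≤ Fintype.card ι) (x : ι → ℝ) (i : ι) :
    (Fintype.card ι : ℝ) * ((∑ j, (x j - (∑ k, x k) / Fintype.card ι) ^ 2) / Fintype.card ι)
        - ((Fintype.card ι : ℝ) - 1)
          * ((∑ j ∈ univ.erase i,
                (x j - (∑ k ∈ univ.erase i, x k) / ((Fintype.card ι : ℝ) - 1)) ^ 2)
              / ((Fintype.card ι : ℝ) - 1))
      = Fintype.card ι / ((Fintype.card ι : ℝ) - 1)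
          * (x i - (∑ k, x k) / Fintype.card ι) ^ 2 := by
  have hn0 : (Fintype.card ι : ℝ) ≠ 0 := by
    have : 0 < Fintype.card ι := by omega
    positivity
  have hn1 : (Fintype.card ι : ℝ) - 1 ≠ 0 := by
    have : (2 : ℝ) ≤ Fintype.card ι := by exact_mod_cast hn
    linarith
  rw [sum_erase_sq_sub_looMean hn x i, mul_div_cancel₀ _ hn0, mul_div_cancel₀ _ hn1]
  ring

/-- **QUENOUILLE'S EXAMPLE, EXACTLY: the jackknife bias-corrected plug-in variance is the
unbiased sample variance** — `n·V − (n−1)·(1/n)Σ_i V_{(−i)} = (1/(n−1))Σ_i (x_i − x̄)²`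
(`n ≥ 2`). -/
theorem jackknife_biasCorrected_plugInVariance_eq_sampleVariance (hn : 2 ≤ Fintype.card ι)
    (x : ι → ℝ) :
    (Fintype.card ι : ℝ) * ((∑ j, (x j - (∑ k, x k) / Fintype.card ι) ^ 2) / Fintype.card ι)
        - ((Fintype.card ι : ℝ) - 1)
          * ((∑ i, (∑ j ∈ univ.erase i,
                (x j - (∑ k ∈ univ.erase i, x k) / ((Fintype.card ι : ℝ) - 1)) ^ 2)
              / ((Fintype.card ι : ℝ) - 1)) / Fintype.card ι)
      = (∑ j, (x j - (∑ k, x k) / Fintype.card ι) ^ 2) / ((Fintype.card ι : ℝ) - 1) := by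
  have hn0 : (Fintype.card ι : ℝ) ≠ 0 := by
    have : 0 < Fintype.card ι := by omega
    positivity
  have hn1 : (Fintype.card ι : ℝ) - 1 ≠ 0 := by
    have : (2 : ℝ) ≤ Fintype.card ι := by exact_mod_cast hn
    linarith
  -- average the pseudo-value identity over `i`
  have hps := fun i => pseudoValue_plugInVariance_eq hn x i
  have hsum : ∑ i, ((Fintype.card ι : ℝ)
        * ((∑ j, (x j - (∑ k, x k) / Fintype.card ι) ^ 2) / Fintype.card ι)
        - ((Fintype.card ι : ℝ) - 1)
          * ((∑ j ∈ univ.erase i,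
                (x j - (∑ k ∈ univ.erase i, x k) / ((Fintype.card ι : ℝ) - 1)) ^ 2)
              / ((Fintype.card ι : ℝ) - 1)))
      = ∑ i, Fintype.card ι / ((Fintype.card ι : ℝ) - 1)
          * (x i - (∑ k, x k) / Fintype.card ι) ^ 2 := sum_congr rfl fun i _ => hps i
  rw [sum_sub_distrib, sum_const, card_univ, nsmul_eq_mul, ← mul_sum, ← mul_sum] at hsum
  -- `hsum : n·(n·V) − (n−1)·Σ_i V_{(−i)} = (n/(n−1))·Σ_i (x_i − x̄)²`; solve for `Σ_i V_{(−i)}`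
  set S := ∑ i, (∑ j ∈ univ.erase i,
      (x j - (∑ k ∈ univ.erase i, x k) / ((Fintype.card ι : ℝ) - 1)) ^ 2)
        / ((Fintype.card ι : ℝ) - 1) with hS
  set Q := ∑ j, (x j - (∑ k, x k) / Fintype.card ι) ^ 2 with hQ
  have hS' : S = ((Fintype.card ι : ℝ) * ((Fintype.card ι : ℝ) * (Q / Fintype.card ι))
      - Fintype.card ι / ((Fintype.card ι : ℝ) - 1) * Q) / ((Fintype.card ι : ℝ) - 1) := by
    rw [eq_div_iff hn1]
    linear_combination -hsum
  rw [hS']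
  field_simp
  ring

end PlugInVariance

end Summit.Ventures.LatticeQCDFlow.Exactness.GeneralNCMC
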